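import Summits.HodgeConjecture.HodgeConjecture.Theorems.SixfoldTableXCensusProductRowsSix
import Summits.HodgeConjecture.HodgeConjecture.Theorems.SixfoldTableXCensusRibetTypeOneRow
import Literature.AlgebraicGeometry.HodgeTheory.UnitaryTypeOneTimesCMCurveProductSpan
import Literature.AlgebraicGeometry.HodgeTheory.RankOneCentreTimesCMCurveProductSpan
import Literature.AlgebraicGeometry.HodgeTheory.RankOneCentreTimesSimpleCMSurfaceProductSpan
import Literature.AlgebraicGeometry.Motives.AbelianVarietyEndAlgebraIsogenyInvariance
import HarnessLib

/-!
# TABLE X (dimension 6) — the census nodes X2 / X1 DISCHARGED IN THE KERNEL on the Künneth rows WITH A TYPE-IV(1,1)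
# FACTOR (`End⁰ = ℚ(√-d)`) whose product span is a PROVED tree theorem: `Y₅(4,1) × E_CM` (TABLE X row 18, the
# resonant case included), `Y₅ × E_{k'}` with `k' ≇ k` (any signature), `Y₄ × S` with `S` a simple CM surface —
# unconditionally (cell `pub-hodgeav-hg6`, req-37 (A) Q2b; eng-5 g4, sequel of L9 / L9b `SixfoldTableXCensusProductRows{,Six}`)

HONEST FRAMING. HC, `HC_AV` (stmt-1333), `HC_CM` (stmt-3052) and the rung H2 are NOT proved and do not occur here. The
census nodes `TableX.SixfoldCodimTwoCensus` (X2) / `TableX.SixfoldCodimThreeCensus` (X1) of `SixfoldTableXCover` are OURS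
(`@[conjecture]`), never asserted. KERNEL ONLY: theorems over existing declarations; no definition, no `sorry`, no named
fact (every input is a THEOREM of the tree); typed ≠ proved.

WHY THIS MODULE (census-node self-audit, axis A7 «a row VERIFIED in the kernel, not by dossier», continued). L9 ran the
KÜNNETH mechanism (`HodgeClassesProductSpan B C` ⟹ X2-at-`A` ∧ X1-at-`A` for every `A ∼ B × C`, entry point
`ProductRows.census_of_isIsogenous_prod_of_productSpan`) on three PROVED product-span theorems of the tree, all with a factor
of types I–III or a generic factor: (a) no-type-IV × CM (Lombardo), (b) × non-CM curve, (c) × generic stably nondegenerate.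
The tree ALSO proves the product span for products whose large factor is of TYPE IV(1,1) — `End⁰(Y) = ℚ(√-d)`, i.e.
`dim_ℚ End⁰(Y) = 2` with `φ ≫ φ = -d`, `d > 0` —, the Lie step being the unitary `Θ`-annihilator theorems of the Literature
lane (cell `pub-hodge-ring2`, programmes R28 / R29 and the simple-CM-surface sequel):
* (d) `hodgeClassesProductSpan_of_unitaryTypeOne_cmCurve` (`UnitaryTypeOneTimesCMCurveProductSpan`): `Y` of unitary type
  `(dim Y − 1, 1)`, `dim Y ≥ 4`, times ANY elliptic curve `E` with complex multiplication (`χ ≫ χ = -d'`), the RESONANT case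
  `k ↪ End⁰(Y)` INCLUDED (Moonen–Zarhin 1999 Thm. 0.2 (3) case (g), §5 (5.10)–(5.11)) — at `dim Y = 5` this is **TABLE X ROW 18
  `g6.ExY5.(4,1)` = `E_k × Y₅/k(4,1)`** (`HOME/TABLE-X-g6-v0.md` §1: «S-CERT for X (B = D on X; 7 engines)»; now a KERNEL row)
  together with the non-resonant members `Y₅(4,1) × E_{k'}`;
* (e) `hodgeClassesProductSpan_of_quadraticEnd_cmCurve` (`RankOneCentreTimesCMCurveProductSpan`): `Y` of positive dimension with
  `dim_ℚ End⁰(Y) = 2`, `φ ≫ φ = -d`, ANY signature, times a CM curve `E` with `χ ≫ χ = -d'` and `k' = ℚ(√-d') ≇ ℚ(√-d) = k`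
  (`d ≠ q² d'`; Moonen–Zarhin (3.1), Lemma (3.6), Prop. (3.8)) — at `dim Y = 5`: every `Y₅/k × E_{k'}` with `k' ≇ k`
  (NON-interacting members of TABLE X row 28 carrying a type-IV factor, e.g. `Y₅(3,2) × E_{k'}`: no imaginary quadratic field
  acts on the whole sixfold, so no sixfold Weil class arises);
* (f) `hodgeClassesProductSpan_of_quadraticEnd_simpleCMSurface` (`RankOneCentreTimesSimpleCMSurfaceProductSpan`): the same `Y`
  times a SIMPLE CM abelian surface `S` (CM type realised by a quartic CM field; simplicity forces the field to have no
  imaginary quadratic subfield, so no resonance) — at `dim Y = 4`: every `Y₄/k × S` (row-28 members).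
On each such product and on EVERYTHING ISOGENOUS to it both census conclusions hold (L9 §1), and these sixfolds are IN THE
NODES' DOMAIN `dim = 6 ∧ ¬ 𝒞` (`𝒞` = CM ∪ K3-partner cell, verbatim as L6 / L7): the type-IV(1,1) factor `Y` is SIMPLE and
NOT of CM type (eng-2 g4's L11 `TypeIVRows.isSimple_and_not_isOfCMType_of_ribetTypeOne`: `End⁰(Y)` is the field `ℚ(√-d)` of
degree `2 < 2 dim Y`), so `A ∼ Y × C` is not of CM type (L9 `not_isOfCMType_of_isIsogenous_prod_of_left`), and a simple
quartic-field type-IV FOURFOLD `Y'` with `A ∼ Y' × Z` would be a simple isogeny factor of `Y` — i.e. `Y' ∼ Y`, impossible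
when `dim Y = 5`, and when `dim Y = 4` because `dim_ℚ End⁰` is an isogeny invariant (`2 ≠ 4`) — or of the simple factor `C`
of dimension `< 4` (§1, the pattern of L9 §3).

* §1 `not_prodCMCell_quarticTypeIV_of_isIsogenous_prod_of_isSimple`, `not_residueClass_of_isIsogenous_prod_of_isSimple_of_not_isOfCMType`
  — off-residue for `A ∼ Y × C`, `Y` simple non-CM with `dim Y ≠ 4 ∨ dim_ℚ End⁰(Y) ≠ 4`, `C` simple of dimension `< 4`.
* §2 the three census instances on the whole isogeny class (any dimension): `census_of_isIsogenous_unitaryTypeOne_prod_cmCurve`,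
  `census_of_isIsogenous_quadraticEnd_prod_cmCurve_of_ne`, `census_of_isIsogenous_quadraticEnd_prod_simpleCMSurface`.
* §3 dimension 6 WITH domain membership: **`sixfoldCensus_row18_unitaryFourOne_prod_cmCurve`** (row 18 and its non-resonant
  twins), `sixfoldCensus_of_isIsogenous_quadraticEndFivefold_prod_cmCurve_of_ne`, `sixfoldCensus_of_isIsogenous_quadraticEndFourfold_prod_simpleCMSurface`.
All declarations live in the namespace `TableX.ProductRows` of L9 (continued; nothing of L9 / L9b / L10 / L11 is restated —
their entry points are IMPORTED, lead g2 dedup rule 2026-08-28T20:17:40Z).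

WHAT IS NOT COVERED (honest scope): the INTERACTING type-IV rows 17 / 19 / 20 / 22 / 27 (an imaginary quadratic `k` acting
`(3,3)` on the sixfold: Weil carriers, `B³ ≠` products — R-W6, by design outside the Künneth mechanism), row 21 (S-W4, known by
Floccari–Fu through the factor, not a Künneth row of `X` itself), the K3P rows 23 / 24 / 26 and the CM rows; products
`Y₅(3,2) × E_k` with the SAME `k` are row 17 (Weil), correctly excluded by the hypothesis `d ≠ q² d'` of (e) and by the
multiplicity-`1` hypothesis of (d). No inhabitant is exhibited (the tree holds no existence record of a `(4,1)` fivefold or a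
`(3,1)` / `(2,2)` fourfold with `End⁰ = ℚ(√-d)`; none is invented here — the row theorems are implications).

Nothing here is a corollary of `HC_CM`; no hypothesis of the cover is discharged GLOBALLY (X2 / X1 quantify over ALL
off-residue sixfolds and stay `@[conjecture]`); typed ≠ proved.
-/

set_option linter.dupNamespace false

noncomputable section

open CategoryTheory MonoidalCategory CartesianMonoidalCategory NumberField
open Literature.AlgebraicGeometry Literature.AlgebraicGeometry.Motives
open Literature.AlgebraicGeometry.Motives.AbelianVariety (IsIsogenous IsSimple)
open Literature.AlgebraicGeometry.HodgeTheory
open Literature.AlgebraicGeometry.ComplexMultiplication (IsCMTypeRealisation)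
open Literature.AlgebraicGeometry.Milne1999
open Literature.AlgebraicTopology.SingularHomology
open Literature.Barriers.HodgeConjecture
open Summit.HodgeConjecture.HodgeConjecture.Ring2.ClassTargets
open Summit.HodgeConjecture.HodgeConjecture.Ring2.Motiv (ProdCMCell)
open Summit.HodgeConjecture.HodgeConjecture.Ring2.Atlas (IsQuarticFieldTypeIVFourfold)
open Summit.HodgeConjecture.HodgeConjecture.TableX.TypeIVRows (isSimple_and_not_isOfCMType_of_ribetTypeOne)

namespace Summit.HodgeConjecture.HodgeConjecture.TableX.ProductRows

/-! ## §1 Off the residue class: `A ∼ Y × C` with `Y` SIMPLE non-CM (not a quartic-field fourfold) and `C` simple small -/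

/-- **`A ∼ Y × C` IS NOT IN THE K3-PARTNER CELL** when `Y` is SIMPLE of positive dimension with `dim Y ≠ 4` or
`dim_ℚ End⁰(Y) ≠ 4`, and `C` is SIMPLE of positive dimension `< 4`: a simple quartic-field type-IV fourfold `Y'` with
`A ∼ Y' × Z` is a simple isogeny factor of `Y × C` (Milne 1986 §12), i.e. `Y' ∼ Y` — then `dim Y = 4` AND
`dim_ℚ End⁰(Y) = dim_ℚ End⁰(Y') = 4` (isogeny invariance of `End⁰`, Mumford §19) — or `Y' ∼ C` — then `4 = dim C < 4`.
[cite: Milne1986AbelianVarieties, §12 p. 122] [cite: MumfordAV1970, §19 Remark p. 169 and Cor. 1–2 (pp. 173–174)] -/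
theorem not_prodCMCell_quarticTypeIV_of_isIsogenous_prod_of_isSimple {A Y C : AbelianVariety ℂ} (hYs : Y.IsSimple)
    (h0Y : 0 < Y.dim) (hY : Y.dim ≠ 4 ∨ Module.finrank ℚ Y.endAlgebra ≠ 4) (hCs : C.IsSimple) (h0C : 0 < C.dim)
    (hC4 : C.dim < 4) (hA : IsIsogenous A (Y.prod C)) :
    ¬ ProdCMCell IsQuarticFieldTypeIVFourfold (fun Z ↦ Z.dim = 2) A := by
  rintro ⟨Y', Z, hYZ, hY', -, -⟩
  obtain ⟨hY'4, hY's, -, hY'rk, -⟩ := hY'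
  have hfacA : IsSimpleIsogenyFactor Y' A :=
    (isSimpleIsogenyFactor_congr_right hYZ).mpr ((isSimpleIsogenyFactor_self hY's (by omega)).prod_left)
  have hfac : IsSimpleIsogenyFactor Y' (Y.prod C) := (isSimpleIsogenyFactor_congr_right hA).mp hfacA
  rcases isSimpleIsogenyFactor_prod_iff.mp hfac with h | h
  · have hiso : IsIsogenous Y' Y := (isSimpleIsogenyFactor_iff_isIsogenous_of_isSimple hYs h0Y).mp h
    rcases hY with hY | hY
    · exact hY (hiso.dim_eq ▸ hY'4)
    · exact hY (hiso.finrank_endAlgebra_eq ▸ hY'rk)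
  · have hdim := ((isSimpleIsogenyFactor_iff_isIsogenous_of_isSimple hCs h0C).mp h).dim_eq
    omega

/-- **`A ∼ Y × C` is OFF the residue class `𝒞 = CM ∪ K3P`** (`𝒞` spelled exactly as in L6 / L7) when `Y` is SIMPLE, NOT of
CM type, with `dim Y ≠ 4 ∨ dim_ℚ End⁰(Y) ≠ 4`, and `C` is simple of positive dimension `< 4`: not CM because CM type passes
to the factor `Y` (L9 `not_isOfCMType_of_isIsogenous_prod_of_left`), not K3P by the previous theorem.
[cite: Milne1999, §2 p. 54] [cite: Milne1986AbelianVarieties, §12 p. 122] -/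
theorem not_residueClass_of_isIsogenous_prod_of_isSimple_of_not_isOfCMType {A Y C : AbelianVariety ℂ}
    (hYs : Y.IsSimple) (hYcm : ¬ IsOfCMType Y) (h0Y : 0 < Y.dim) (hY : Y.dim ≠ 4 ∨ Module.finrank ℚ Y.endAlgebra ≠ 4)
    (hCs : C.IsSimple) (h0C : 0 < C.dim) (hC4 : C.dim < 4) (hA : IsIsogenous A (Y.prod C)) :
    ¬ (IsOfCMType A ∨ ProdCMCell IsQuarticFieldTypeIVFourfold (fun Z ↦ Z.dim = 2) A) :=
  fun h ↦ h.elim (not_isOfCMType_of_isIsogenous_prod_of_left hYcm hA)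
    (not_prodCMCell_quarticTypeIV_of_isIsogenous_prod_of_isSimple hYs h0Y hY hCs h0C hC4 hA)

/-! ## §2 Three Künneth instances with a type-IV(1,1) factor (any dimension): both census conclusions on the isogeny class -/

/-- **ROW (d): `Y` of unitary type `(dim Y − 1, 1)`, `dim Y ≥ 4`, times ANY CM elliptic curve — the resonant case
`k ↪ End⁰(Y)` included.** For every `A ∼ Y × E` both census conclusions X2-at-`A`, X1-at-`A` hold — by the tree's
UNCONDITIONAL product-span theorem `hodgeClassesProductSpan_of_unitaryTypeOne_cmCurve` (Moonen–Zarhin 1999 Thm. 0.2 (3)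
case (g): the annihilator of a Hodge class of `(H¹(Y) ⊕ H¹(E))^{⊗}` contains `𝔰𝔲(W) ⊕ 0`, and the `𝔰𝔲(W)`-invariants are
the `𝔲(W)`-invariants away from top degree) fed into L9's Künneth entry point. [cite: MoonenZarhin1999LowDim, Thm. 0.2 (3) and §5 (5.10)–(5.11)]
[cite: MoonenZarhin1999LowDim, §3 (3.1)] [cite: Ribet1983, Thm. 3] -/
theorem census_of_isIsogenous_unitaryTypeOne_prod_cmCurve {A Y E : AbelianVariety ℂ} (hY4 : 4 ≤ Y.dim)
    (hY2 : Module.finrank ℚ Y.endAlgebra = 2) (φY : Y ⟶ Y) {d : ℕ} (hd : 0 < d) (hφY : φY ≫ φY = -(d • 𝟙 Y))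
    (hm1 : eigenMultiplicity Y φY (Complex.I * (Real.sqrt d : ℂ)) = 1 ∨
      eigenMultiplicity Y φY (-(Complex.I * (Real.sqrt d : ℂ))) = 1)
    (hE1 : E.dim = 1) (χ : E ⟶ E) {d' : ℕ} (hd' : 0 < d') (hχ : χ ≫ χ = -(d' • 𝟙 E))
    (hA : IsIsogenous A (Y.prod E)) :
    (∀ c : complexBetti A.X (2 * 2), IsRationalClass c → IsOfHodgeType A.dim A.X (2 * 2) 2 2 c →
      c ∈ divisorClassesSpan A.X A.dim 2 ⊔ Submodule.span ℂ {w' : complexBetti A.X (2 * 2) |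
        ∃ (C : AbelianVariety ℂ) (g : A.X ⟶ C.X) (w : complexBetti C.X (2 * 2)), C.dim < A.dim ∧
          IsRationalClass w ∧ IsOfHodgeType C.dim C.X (2 * 2) 2 2 w ∧ w' = complexBetti.map g (2 * 2) w}) ∧
    (∀ c : complexBetti A.X (2 * 3), IsRationalClass c → IsOfHodgeType A.dim A.X (2 * 3) 3 3 c →
      c ∈ divisorClassesSpan A.X A.dim 3 ⊔ Submodule.span ℂ {w' : complexBetti A.X (2 * 3) |
          ∃ (a : complexBetti A.X (2 * 2)) (b : complexBetti A.X (2 * 1)),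
            IsRationalClass a ∧ IsOfHodgeType A.dim A.X (2 * 2) 2 2 a ∧ IsRationalClass b ∧
            IsOfHodgeType A.dim A.X (2 * 1) 1 1 b ∧ w' = cupProduct (two_mul_add_two_mul 2 1) a b} ⊔
        Submodule.span ℂ {w' : complexBetti A.X (2 * 3) |
          ∃ (C : AbelianVariety ℂ) (g : A.X ⟶ C.X) (w : complexBetti C.X (2 * 3)), C.dim < A.dim ∧
            IsRationalClass w ∧ IsOfHodgeType C.dim C.X (2 * 3) 3 3 w ∧ w' = complexBetti.map g (2 * 3) w} ⊔
        Submodule.span ℂ {w' : complexBetti A.X (2 * 3) |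
          ∃ (B' : AbelianVariety ℂ) (g : A.X ⟶ B'.X) (d : ℕ) (ψ : B' ⟶ B') (w : complexBetti B'.X (2 * 3)),
            B'.dim = 6 ∧ 0 < d ∧ ψ ≫ ψ = -(d • 𝟙 B') ∧ IsRationalClass w ∧
            IsOfHodgeType B'.dim B'.X (2 * 3) 3 3 w ∧ w ∈ weilClassesOf B' ψ 3 d ∧
            w' = complexBetti.map g (2 * 3) w}) :=
  census_of_isIsogenous_prod_of_productSpan (by omega) (by omega)
    (hodgeClassesProductSpan_of_unitaryTypeOne_cmCurve hY4 hY2 φY hd hφY hm1 hE1 χ hd' hχ) hA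

/-- **ROW (e): `Y` with `End⁰(Y) = ℚ(√-d)` (ANY signature, `dim Y > 0`) times a CM elliptic curve `E_{k'}` with
`k' = ℚ(√-d') ≇ ℚ(√-d)` (`d ≠ q² d'` for all `q ∈ ℚ`).** For every `A ∼ Y × E` both census conclusions hold — by the
tree's UNCONDITIONAL `hodgeClassesProductSpan_of_quadraticEnd_cmCurve` (Moonen–Zarhin 1999 (3.1), Lemma (3.6), Prop. (3.8):
no embedding of `k'` into the centre `k` of `End⁰(Y)`). [cite: MoonenZarhin1999LowDim, §3 (3.1), Lemma (3.6) and Prop. (3.8)] -/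
theorem census_of_isIsogenous_quadraticEnd_prod_cmCurve_of_ne {A Y E : AbelianVariety ℂ} (h0Y : 0 < Y.dim)
    (hY2 : Module.finrank ℚ Y.endAlgebra = 2) (φY : Y ⟶ Y) {d : ℕ} (hd : 0 < d) (hφY : φY ≫ φY = -(d • 𝟙 Y))
    (hE1 : E.dim = 1) (χ : E ⟶ E) {d' : ℕ} (hd' : 0 < d') (hχ : χ ≫ χ = -(d' • 𝟙 E))
    (hfree : ∀ q : ℚ, (d : ℚ) ≠ q ^ 2 * d') (hA : IsIsogenous A (Y.prod E)) :
    (∀ c : complexBetti A.X (2 * 2), IsRationalClass c → IsOfHodgeType A.dim A.X (2 * 2) 2 2 c →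
      c ∈ divisorClassesSpan A.X A.dim 2 ⊔ Submodule.span ℂ {w' : complexBetti A.X (2 * 2) |
        ∃ (C : AbelianVariety ℂ) (g : A.X ⟶ C.X) (w : complexBetti C.X (2 * 2)), C.dim < A.dim ∧
          IsRationalClass w ∧ IsOfHodgeType C.dim C.X (2 * 2) 2 2 w ∧ w' = complexBetti.map g (2 * 2) w}) ∧
    (∀ c : complexBetti A.X (2 * 3), IsRationalClass c → IsOfHodgeType A.dim A.X (2 * 3) 3 3 c →
      c ∈ divisorClassesSpan A.X A.dim 3 ⊔ Submodule.span ℂ {w' : complexBetti A.X (2 * 3) |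
          ∃ (a : complexBetti A.X (2 * 2)) (b : complexBetti A.X (2 * 1)),
            IsRationalClass a ∧ IsOfHodgeType A.dim A.X (2 * 2) 2 2 a ∧ IsRationalClass b ∧
            IsOfHodgeType A.dim A.X (2 * 1) 1 1 b ∧ w' = cupProduct (two_mul_add_two_mul 2 1) a b} ⊔
        Submodule.span ℂ {w' : complexBetti A.X (2 * 3) |
          ∃ (C : AbelianVariety ℂ) (g : A.X ⟶ C.X) (w : complexBetti C.X (2 * 3)), C.dim < A.dim ∧
            IsRationalClass w ∧ IsOfHodgeType C.dim C.X (2 * 3) 3 3 w ∧ w' = complexBetti.map g (2 * 3) w} ⊔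
        Submodule.span ℂ {w' : complexBetti A.X (2 * 3) |
          ∃ (B' : AbelianVariety ℂ) (g : A.X ⟶ B'.X) (d : ℕ) (ψ : B' ⟶ B') (w : complexBetti B'.X (2 * 3)),
            B'.dim = 6 ∧ 0 < d ∧ ψ ≫ ψ = -(d • 𝟙 B') ∧ IsRationalClass w ∧
            IsOfHodgeType B'.dim B'.X (2 * 3) 3 3 w ∧ w ∈ weilClassesOf B' ψ 3 d ∧
            w' = complexBetti.map g (2 * 3) w}) :=
  census_of_isIsogenous_prod_of_productSpan h0Y (by omega)
    (hodgeClassesProductSpan_of_quadraticEnd_cmCurve h0Y hY2 φY hd hφY hE1 χ hd' hχ hfree) hA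

/-- **ROW (f): `Y` with `End⁰(Y) = ℚ(√-d)` (any signature, `dim Y > 0`) times a SIMPLE CM abelian surface `S`** (CM type
`Φ` of a quartic CM field `K` realised on `S`). For every `A ∼ Y × S` both census conclusions hold — by the tree's
UNCONDITIONAL `hodgeClassesProductSpan_of_quadraticEnd_simpleCMSurface` (Moonen–Zarhin 1999 (3.1) and Lemma (3.6); `S`
simple ⟹ `K` has no imaginary quadratic subfield, so `Hg(Y × S) = Hg(Y) × Hg(S)`).
[cite: MoonenZarhin1999LowDim, §3 (3.1) and Lemma (3.6)] [cite: Shimura1998, §5.1 and §8.4] -/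
theorem census_of_isIsogenous_quadraticEnd_prod_simpleCMSurface {A Y S : AbelianVariety ℂ} (h0Y : 0 < Y.dim)
    (hY2 : Module.finrank ℚ Y.endAlgebra = 2) (φY : Y ⟶ Y) {d : ℕ} (hd : 0 < d) (hφY : φY ≫ φY = -(d • 𝟙 Y))
    {K : Type} [Field K] [NumberField K] [IsCMField K] {Φ : CMType K} {ιS : 𝓞 K →+* End S}
    {θ : K →+* Module.End ℂ (complexBetti S.X 1)} (hreal : IsCMTypeRealisation Φ S ιS θ)
    (hK4 : Module.finrank ℚ K = 4) (hSs : S.IsSimple) (hS2 : S.dim = 2) (hA : IsIsogenous A (Y.prod S)) :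
    (∀ c : complexBetti A.X (2 * 2), IsRationalClass c → IsOfHodgeType A.dim A.X (2 * 2) 2 2 c →
      c ∈ divisorClassesSpan A.X A.dim 2 ⊔ Submodule.span ℂ {w' : complexBetti A.X (2 * 2) |
        ∃ (C : AbelianVariety ℂ) (g : A.X ⟶ C.X) (w : complexBetti C.X (2 * 2)), C.dim < A.dim ∧
          IsRationalClass w ∧ IsOfHodgeType C.dim C.X (2 * 2) 2 2 w ∧ w' = complexBetti.map g (2 * 2) w}) ∧
    (∀ c : complexBetti A.X (2 * 3), IsRationalClass c → IsOfHodgeType A.dim A.X (2 * 3) 3 3 c →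
      c ∈ divisorClassesSpan A.X A.dim 3 ⊔ Submodule.span ℂ {w' : complexBetti A.X (2 * 3) |
          ∃ (a : complexBetti A.X (2 * 2)) (b : complexBetti A.X (2 * 1)),
            IsRationalClass a ∧ IsOfHodgeType A.dim A.X (2 * 2) 2 2 a ∧ IsRationalClass b ∧
            IsOfHodgeType A.dim A.X (2 * 1) 1 1 b ∧ w' = cupProduct (two_mul_add_two_mul 2 1) a b} ⊔
        Submodule.span ℂ {w' : complexBetti A.X (2 * 3) |
          ∃ (C : AbelianVariety ℂ) (g : A.X ⟶ C.X) (w : complexBetti C.X (2 * 3)), C.dim < A.dim ∧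
            IsRationalClass w ∧ IsOfHodgeType C.dim C.X (2 * 3) 3 3 w ∧ w' = complexBetti.map g (2 * 3) w} ⊔
        Submodule.span ℂ {w' : complexBetti A.X (2 * 3) |
          ∃ (B' : AbelianVariety ℂ) (g : A.X ⟶ B'.X) (d : ℕ) (ψ : B' ⟶ B') (w : complexBetti B'.X (2 * 3)),
            B'.dim = 6 ∧ 0 < d ∧ ψ ≫ ψ = -(d • 𝟙 B') ∧ IsRationalClass w ∧
            IsOfHodgeType B'.dim B'.X (2 * 3) 3 3 w ∧ w ∈ weilClassesOf B' ψ 3 d ∧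
            w' = complexBetti.map g (2 * 3) w}) :=
  census_of_isIsogenous_prod_of_productSpan h0Y (by omega)
    (hodgeClassesProductSpan_of_quadraticEnd_simpleCMSurface h0Y hY2 φY hd hφY hreal hK4 hSs) hA

/-! ## §3 Dimension 6, WITH domain membership: row 18 and the two row-28 families -/

/-- **TABLE X ROW 18 `g6.ExY5.(4,1)` (and its non-resonant twins), VERIFIED IN THE KERNEL.** Every complex abelian variety
`A` isogenous to `Y × E` with `Y` a FIVEFOLD of unitary type `(4,1)` — `dim_ℚ End⁰(Y) = 2`, `φ ≫ φ = -d` (`d > 0`), `φ^*` of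
multiplicity `1` on `H^{1,0}(Y)` at `i√d` or at `-i√d` — and `E` ANY elliptic curve with complex multiplication (`χ ≫ χ = -d'`,
`d' > 0`; `E = E_k` itself allowed) is a SIXFOLD OFF THE RESIDUE CLASS `𝒞` — so X2 / X1 speak about it — AND SATISFIES BOTH
census conclusions. UNCONDITIONAL; no named fact. [cite: MoonenZarhin1999LowDim, Thm. 0.2 (3) case (g) and §5 (5.10)–(5.12)]
[cite: Ribet1983, Thm. 3] [cite: Milne1999, §2 p. 54] [cite: Milne1986AbelianVarieties, §12 p. 122] -/
theorem sixfoldCensus_row18_unitaryFourOne_prod_cmCurve {A Y E : AbelianVariety ℂ} (hY5 : Y.dim = 5)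
    (hY2 : Module.finrank ℚ Y.endAlgebra = 2) (φY : Y ⟶ Y) {d : ℕ} (hd : 0 < d) (hφY : φY ≫ φY = -(d • 𝟙 Y))
    (hm1 : eigenMultiplicity Y φY (Complex.I * (Real.sqrt d : ℂ)) = 1 ∨
      eigenMultiplicity Y φY (-(Complex.I * (Real.sqrt d : ℂ))) = 1)
    (hE1 : E.dim = 1) (χ : E ⟶ E) {d' : ℕ} (hd' : 0 < d') (hχ : χ ≫ χ = -(d' • 𝟙 E))
    (hA : IsIsogenous A (Y.prod E)) :
    (A.dim = 6 ∧ ¬ (IsOfCMType A ∨ ProdCMCell IsQuarticFieldTypeIVFourfold (fun Z ↦ Z.dim = 2) A)) ∧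
    (∀ c : complexBetti A.X (2 * 2), IsRationalClass c → IsOfHodgeType A.dim A.X (2 * 2) 2 2 c →
      c ∈ divisorClassesSpan A.X A.dim 2 ⊔ Submodule.span ℂ {w' : complexBetti A.X (2 * 2) |
        ∃ (C : AbelianVariety ℂ) (g : A.X ⟶ C.X) (w : complexBetti C.X (2 * 2)), C.dim < A.dim ∧
          IsRationalClass w ∧ IsOfHodgeType C.dim C.X (2 * 2) 2 2 w ∧ w' = complexBetti.map g (2 * 2) w}) ∧
    (∀ c : complexBetti A.X (2 * 3), IsRationalClass c → IsOfHodgeType A.dim A.X (2 * 3) 3 3 c →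
      c ∈ divisorClassesSpan A.X A.dim 3 ⊔ Submodule.span ℂ {w' : complexBetti A.X (2 * 3) |
          ∃ (a : complexBetti A.X (2 * 2)) (b : complexBetti A.X (2 * 1)),
            IsRationalClass a ∧ IsOfHodgeType A.dim A.X (2 * 2) 2 2 a ∧ IsRationalClass b ∧
            IsOfHodgeType A.dim A.X (2 * 1) 1 1 b ∧ w' = cupProduct (two_mul_add_two_mul 2 1) a b} ⊔
        Submodule.span ℂ {w' : complexBetti A.X (2 * 3) |
          ∃ (C : AbelianVariety ℂ) (g : A.X ⟶ C.X) (w : complexBetti C.X (2 * 3)), C.dim < A.dim ∧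
            IsRationalClass w ∧ IsOfHodgeType C.dim C.X (2 * 3) 3 3 w ∧ w' = complexBetti.map g (2 * 3) w} ⊔
        Submodule.span ℂ {w' : complexBetti A.X (2 * 3) |
          ∃ (B' : AbelianVariety ℂ) (g : A.X ⟶ B'.X) (d : ℕ) (ψ : B' ⟶ B') (w : complexBetti B'.X (2 * 3)),
            B'.dim = 6 ∧ 0 < d ∧ ψ ≫ ψ = -(d • 𝟙 B') ∧ IsRationalClass w ∧
            IsOfHodgeType B'.dim B'.X (2 * 3) 3 3 w ∧ w ∈ weilClassesOf B' ψ 3 d ∧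
            w' = complexBetti.map g (2 * 3) w}) := by
  have hY := isSimple_and_not_isOfCMType_of_ribetTypeOne φY hd hφY hY2 (by omega)
  exact ⟨⟨dim_eq_six_of_isIsogenous_prod hA (by omega),
      not_residueClass_of_isIsogenous_prod_of_isSimple_of_not_isOfCMType hY.1 hY.2 (by omega) (Or.inl (by omega))
        (AbelianVariety.isSimple_of_dim_le_one hE1.le) (by omega) (by omega) hA⟩,
    census_of_isIsogenous_unitaryTypeOne_prod_cmCurve (by omega) hY2 φY hd hφY hm1 hE1 χ hd' hχ hA⟩

/-- **`Y₅/k × E_{k'}` with `k' ≇ k`, VERIFIED IN THE KERNEL** (non-interacting TABLE X row-28 members with a type-IV factor,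
any signature of `k` on `Y`): every `A` isogenous to `Y × E` with `dim Y = 5`, `dim_ℚ End⁰(Y) = 2`, `φ ≫ φ = -d`, and `E`
a CM elliptic curve with `χ ≫ χ = -d'`, `d ≠ q² d'`, is a sixfold off the residue class AND satisfies both census
conclusions. UNCONDITIONAL. [cite: MoonenZarhin1999LowDim, §3 (3.1), Lemma (3.6), Prop. (3.8) and §5 (5.10)–(5.12)]
[cite: Milne1999, §2 p. 54] [cite: Milne1986AbelianVarieties, §12 p. 122] -/
theorem sixfoldCensus_of_isIsogenous_quadraticEndFivefold_prod_cmCurve_of_ne {A Y E : AbelianVariety ℂ}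
    (hY5 : Y.dim = 5) (hY2 : Module.finrank ℚ Y.endAlgebra = 2) (φY : Y ⟶ Y) {d : ℕ} (hd : 0 < d)
    (hφY : φY ≫ φY = -(d • 𝟙 Y)) (hE1 : E.dim = 1) (χ : E ⟶ E) {d' : ℕ} (hd' : 0 < d')
    (hχ : χ ≫ χ = -(d' • 𝟙 E)) (hfree : ∀ q : ℚ, (d : ℚ) ≠ q ^ 2 * d') (hA : IsIsogenous A (Y.prod E)) :
    (A.dim = 6 ∧ ¬ (IsOfCMType A ∨ ProdCMCell IsQuarticFieldTypeIVFourfold (fun Z ↦ Z.dim = 2) A)) ∧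
    (∀ c : complexBetti A.X (2 * 2), IsRationalClass c → IsOfHodgeType A.dim A.X (2 * 2) 2 2 c →
      c ∈ divisorClassesSpan A.X A.dim 2 ⊔ Submodule.span ℂ {w' : complexBetti A.X (2 * 2) |
        ∃ (C : AbelianVariety ℂ) (g : A.X ⟶ C.X) (w : complexBetti C.X (2 * 2)), C.dim < A.dim ∧
          IsRationalClass w ∧ IsOfHodgeType C.dim C.X (2 * 2) 2 2 w ∧ w' = complexBetti.map g (2 * 2) w}) ∧
    (∀ c : complexBetti A.X (2 * 3), IsRationalClass c → IsOfHodgeType A.dim A.X (2 * 3) 3 3 c →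
      c ∈ divisorClassesSpan A.X A.dim 3 ⊔ Submodule.span ℂ {w' : complexBetti A.X (2 * 3) |
          ∃ (a : complexBetti A.X (2 * 2)) (b : complexBetti A.X (2 * 1)),
            IsRationalClass a ∧ IsOfHodgeType A.dim A.X (2 * 2) 2 2 a ∧ IsRationalClass b ∧
            IsOfHodgeType A.dim A.X (2 * 1) 1 1 b ∧ w' = cupProduct (two_mul_add_two_mul 2 1) a b} ⊔
        Submodule.span ℂ {w' : complexBetti A.X (2 * 3) |
          ∃ (C : AbelianVariety ℂ) (g : A.X ⟶ C.X) (w : complexBetti C.X (2 * 3)), C.dim < A.dim ∧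
            IsRationalClass w ∧ IsOfHodgeType C.dim C.X (2 * 3) 3 3 w ∧ w' = complexBetti.map g (2 * 3) w} ⊔
        Submodule.span ℂ {w' : complexBetti A.X (2 * 3) |
          ∃ (B' : AbelianVariety ℂ) (g : A.X ⟶ B'.X) (d : ℕ) (ψ : B' ⟶ B') (w : complexBetti B'.X (2 * 3)),
            B'.dim = 6 ∧ 0 < d ∧ ψ ≫ ψ = -(d • 𝟙 B') ∧ IsRationalClass w ∧
            IsOfHodgeType B'.dim B'.X (2 * 3) 3 3 w ∧ w ∈ weilClassesOf B' ψ 3 d ∧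
            w' = complexBetti.map g (2 * 3) w}) := by
  have hY := isSimple_and_not_isOfCMType_of_ribetTypeOne φY hd hφY hY2 (by omega)
  exact ⟨⟨dim_eq_six_of_isIsogenous_prod hA (by omega),
      not_residueClass_of_isIsogenous_prod_of_isSimple_of_not_isOfCMType hY.1 hY.2 (by omega) (Or.inl (by omega))
        (AbelianVariety.isSimple_of_dim_le_one hE1.le) (by omega) (by omega) hA⟩,
    census_of_isIsogenous_quadraticEnd_prod_cmCurve_of_ne (by omega) hY2 φY hd hφY hE1 χ hd' hχ hfree hA⟩

/-- **`Y₄/k × S` with `S` a SIMPLE CM surface, VERIFIED IN THE KERNEL** (non-interacting TABLE X row-28 members with a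
type-IV(1,1) fourfold factor, signature `(3,1)` or `(2,2)`): every `A` isogenous to `Y × S` with `dim Y = 4`,
`dim_ℚ End⁰(Y) = 2`, `φ ≫ φ = -d`, and `S` a simple abelian surface realising a CM type of a quartic CM field, is a sixfold
off the residue class (`Y ∼` no quartic-FIELD fourfold: `dim_ℚ End⁰` is an isogeny invariant, `2 ≠ 4`) AND satisfies both
census conclusions. UNCONDITIONAL. [cite: MoonenZarhin1999LowDim, §3 (3.1), Lemma (3.6) and §5 (5.10)–(5.12)]
[cite: Shimura1998, §5.1] [cite: Milne1999, §2 p. 54] [cite: MumfordAV1970, §19 Remark p. 169] -/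
theorem sixfoldCensus_of_isIsogenous_quadraticEndFourfold_prod_simpleCMSurface {A Y S : AbelianVariety ℂ}
    (hY4 : Y.dim = 4) (hY2 : Module.finrank ℚ Y.endAlgebra = 2) (φY : Y ⟶ Y) {d : ℕ} (hd : 0 < d)
    (hφY : φY ≫ φY = -(d • 𝟙 Y))
    {K : Type} [Field K] [NumberField K] [IsCMField K] {Φ : CMType K} {ιS : 𝓞 K →+* End S}
    {θ : K →+* Module.End ℂ (complexBetti S.X 1)} (hreal : IsCMTypeRealisation Φ S ιS θ)
    (hK4 : Module.finrank ℚ K = 4) (hSs : S.IsSimple) (hS2 : S.dim = 2) (hA : IsIsogenous A (Y.prod S)) :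
    (A.dim = 6 ∧ ¬ (IsOfCMType A ∨ ProdCMCell IsQuarticFieldTypeIVFourfold (fun Z ↦ Z.dim = 2) A)) ∧
    (∀ c : complexBetti A.X (2 * 2), IsRationalClass c → IsOfHodgeType A.dim A.X (2 * 2) 2 2 c →
      c ∈ divisorClassesSpan A.X A.dim 2 ⊔ Submodule.span ℂ {w' : complexBetti A.X (2 * 2) |
        ∃ (C : AbelianVariety ℂ) (g : A.X ⟶ C.X) (w : complexBetti C.X (2 * 2)), C.dim < A.dim ∧
          IsRationalClass w ∧ IsOfHodgeType C.dim C.X (2 * 2) 2 2 w ∧ w' = complexBetti.map g (2 * 2) w}) ∧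
    (∀ c : complexBetti A.X (2 * 3), IsRationalClass c → IsOfHodgeType A.dim A.X (2 * 3) 3 3 c →
      c ∈ divisorClassesSpan A.X A.dim 3 ⊔ Submodule.span ℂ {w' : complexBetti A.X (2 * 3) |
          ∃ (a : complexBetti A.X (2 * 2)) (b : complexBetti A.X (2 * 1)),
            IsRationalClass a ∧ IsOfHodgeType A.dim A.X (2 * 2) 2 2 a ∧ IsRationalClass b ∧
            IsOfHodgeType A.dim A.X (2 * 1) 1 1 b ∧ w' = cupProduct (two_mul_add_two_mul 2 1) a b} ⊔
        Submodule.span ℂ {w' : complexBetti A.X (2 * 3) |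
          ∃ (C : AbelianVariety ℂ) (g : A.X ⟶ C.X) (w : complexBetti C.X (2 * 3)), C.dim < A.dim ∧
            IsRationalClass w ∧ IsOfHodgeType C.dim C.X (2 * 3) 3 3 w ∧ w' = complexBetti.map g (2 * 3) w} ⊔
        Submodule.span ℂ {w' : complexBetti A.X (2 * 3) |
          ∃ (B' : AbelianVariety ℂ) (g : A.X ⟶ B'.X) (d : ℕ) (ψ : B' ⟶ B') (w : complexBetti B'.X (2 * 3)),
            B'.dim = 6 ∧ 0 < d ∧ ψ ≫ ψ = -(d • 𝟙 B') ∧ IsRationalClass w ∧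
            IsOfHodgeType B'.dim B'.X (2 * 3) 3 3 w ∧ w ∈ weilClassesOf B' ψ 3 d ∧
            w' = complexBetti.map g (2 * 3) w}) := by
  have hY := isSimple_and_not_isOfCMType_of_ribetTypeOne φY hd hφY hY2 (by omega)
  exact ⟨⟨dim_eq_six_of_isIsogenous_prod hA (by omega),
      not_residueClass_of_isIsogenous_prod_of_isSimple_of_not_isOfCMType hY.1 hY.2 (by omega) (Or.inr (by omega))
        hSs (by omega) (by omega) hA⟩,
    census_of_isIsogenous_quadraticEnd_prod_simpleCMSurface (by omega) hY2 φY hd hφY hreal hK4 hSs hS2 hA⟩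

end Summit.HodgeConjecture.HodgeConjecture.TableX.ProductRows
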